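import Summits.Ventures.PercRepro.C026

/-!
# C-028: the Cauchy–Schwarz class form of the Harris defect (typer-2, gen 10)

C-028 (mine-4 g6, `conjectures/MINE-4.md` §23.3–23.4; C-id by the lead 2026-08-22T19:06:52Z,
RANKED 19 / position 13 at (id) 19:50:49Z; CONJECTURES v294 row C-028, typed 1-1 from the row):
for every marked multigraph (marks `a, b, c`) and every `p ∈ [0, 1]^E`, with the Harris defect
`d := P(a~b)·P(c iso) − P(ab|c)` (`c iso` = `c ≁ a ∧ c ≁ b`; `ab|c` = `a ~ b`, `c` isolated from
them) and the one-sided cells `y₂ = P(ac|b)`, `y₃ = P(bc|a)`: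

  `d ≤ √(y₂ · y₃)`.

On the `law3` rows `x, y₁, y₂, y₃, z` (rows `0 … 4` = `abc, ab|c, ac|b, bc|a, a|b|c`; `P(a~b) =
x + y₁`, `P(c iso) = y₁ + z`, `P(ab|c) = y₁`) this is `(x + y₁)(y₁ + z) − y₁ ≤ √(y₂ · y₃)`
(**`C028`**).  Its AM corollary `2·d ≤ y₂ + y₃` is the (2×) form (**`C028Twice`**); C-026
(`d ≤ y₂ + y₃`, p5's `C026`) follows from either (**`C026_of_C028`**, **`C026_of_C028Twice`**),
so C-028 strengthens C-026 (the row's "strengthens C-026").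

At the CLASS level (mine-4 §23: counts over all `S ⊆ E` of one marked multigraph) the row reads
`badbot² ≤ ac · bc` with `badbot = P − #ab|c`, `P = #{S : a ~_S b, c ≁ a and c ≁ b in E ∖ S}`,
`ac = #ac|b`, `bc = #bc|a`.  In the tree's vocabulary a count over `S ⊆ E` of a condition on the
marked partitions of `S` and of its complement is the cube sum `G.cubeSumQuad m K` of a row
kernel `K` (`ClassPositive.lean`: `cubeSum K c = Σ_ρ K (c ρ) (c ρᶜ)`): `badbot` is the cube sum of
**`kernel28 σ τ = [σ joins ab]·[τ isolates c] − [σ = ab|c]`**, and `ac`, `bc` the cube sums of the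
row kernels `rowKernel3 2`, `rowKernel3 3` — **`C028Class`**.

NOT typed here (listed in the row, "not separate rows"): the D-free residual forms (A)
`2·KL ≤ Kc + Lc` and (CS2) `KL² ≤ Kc · Lc` — their columns `KL, Kc, Lc` are defined through
mine-4's image maps `τ₅₀ / τ₁₈` and the `E1 / o1 / o2` types (MINE-4.md §23), which are not in the
tree's vocabulary.  TODO(typing): define the image maps first.
-/

namespace PercRepro

open Finset

/-- **C-028** (mine-4 g6, MINE-4.md §23.3–23.4, CONJECTURES v294 row C-028 — the Cauchy–Schwarz
class form of the Harris defect): for every finite multigraph, `p ∈ [0,1]^E` and marks `a, b, c`,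
`P(a~b)·P(c iso) − P(ab|c) ≤ √(P(ac|b) · P(bc|a))` — on the `law3` rows
`(x + y₁)(y₁ + z) − y₁ ≤ √(y₂ · y₃)`.  The `√` is `Real.sqrt`, as the row states it.  (By Harris —
`{a ~ b}` increasing, `{c iso}` decreasing, `harris_upper_lower` — `d ≥ 0`, so the squared form
`d² ≤ y₂ · y₃` is equivalent to this one; it is not what the row states and is not typed here.  The
squared form at the class level is `C028Class` below.) -/
def C028 : Prop :=
  ∀ {V E : Type} [Fintype E] [DecidableEq E] (G : MultiGraph V E) (p : E → ℝ), IsProb p →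
    ∀ a b c : V,
      (G.law3 p a b c 0 + G.law3 p a b c 1) * (G.law3 p a b c 1 + G.law3 p a b c 4) -
          G.law3 p a b c 1 ≤
        Real.sqrt (G.law3 p a b c 2 * G.law3 p a b c 3)

/-- **The (2×) form** (the AM corollary of C-028 = C-026's class form doubled, row C-028):
`2·(P(a~b)·P(c iso) − P(ab|c)) ≤ P(ac|b) + P(bc|a)` — on the `law3` rows
`2·((x + y₁)(y₁ + z) − y₁) ≤ y₂ + y₃`. -/
def C028Twice : Prop :=
  ∀ {V E : Type} [Fintype E] [DecidableEq E] (G : MultiGraph V E) (p : E → ℝ), IsProb p →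
    ∀ a b c : V,
      2 * ((G.law3 p a b c 0 + G.law3 p a b c 1) * (G.law3 p a b c 1 + G.law3 p a b c 4) -
          G.law3 p a b c 1) ≤
        G.law3 p a b c 2 + G.law3 p a b c 3

/-- **The kernel of the Harris defect**: `[σ joins ab]·[τ isolates c] − [σ = ab|c]` through the
rows (`a ~ b` = rows `0, 1`; `c ≁ a ∧ c ≁ b` = rows `1, 4`; `ab|c` = row `1`).  Its cube sum on a
marked multigraph is mine-4's `badbot = P − #ab|c` (MINE-4.md §23), and its quadratic form at `p`
is the Harris defect `d`.  (`kernel28 σ τ = rowInd3 2 σ + rowInd3 3 σ − kernel26 σ τ`.) -/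
noncomputable def kernel28 (σ τ : Setoid (Fin 3)) : ℝ :=
  (rowInd3 0 σ + rowInd3 1 σ) * (rowInd3 1 τ + rowInd3 4 τ) - rowInd3 1 σ

/-- The row kernel of row `s`: `[σ = row s]`, independent of `τ`; its cube sum on a marked
multigraph is the number of configurations in row `s` (`ac = #ac|b` for `s = 2`, `bc = #bc|a`
for `s = 3`). -/
noncomputable def rowKernel3 (s : Fin 5) (σ _τ : Setoid (Fin 3)) : ℝ := rowInd3 s σ

/-- **C-028 at the class level** (mine-4 g6, MINE-4.md §23, row C-028 "equivalently at the CLASS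
level for three marked vertices `badbot² ≤ ac · bc`"): for every finite multigraph and every
3-marking `m`, `(cube sum of kernel28)² ≤ (cube sum of [ac|b]) · (cube sum of [bc|a])`, i.e.
`(P − #ab|c)² ≤ #ac|b · #bc|a` with the counts over all `S ⊆ E`. -/
def C028Class : Prop :=
  ∀ {V E : Type} [Fintype E] [DecidableEq E] (G : MultiGraph V E) (m : Fin 3 → V),
    (G.cubeSumQuad m kernel28) ^ 2 ≤
      G.cubeSumQuad m (rowKernel3 2) * G.cubeSumQuad m (rowKernel3 3)

/-- `kernel28` is `rowInd3 2 + rowInd3 3 − kernel26` (C-026's kernel, p5's `C026.lean`). -/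
theorem kernel28_eq (σ τ : Setoid (Fin 3)) :
    kernel28 σ τ = rowInd3 2 σ + rowInd3 3 σ - kernel26 σ τ := by
  unfold kernel28 kernel26; ring

/-- **C-028 gives the (2×) form** (AM–GM: `√(y₂ y₃) ≤ (y₂ + y₃)/2`, the cells being
nonnegative). -/
theorem C028Twice_of_C028 (h : C028) : C028Twice := by
  intro V E _ _ G p hp a b c
  have h2 : 0 ≤ G.law3 p a b c 2 := prob_nonneg hp _
  have h3 : 0 ≤ G.law3 p a b c 3 := prob_nonneg hp _
  have hs : Real.sqrt (G.law3 p a b c 2 * G.law3 p a b c 3) ≤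
      (G.law3 p a b c 2 + G.law3 p a b c 3) / 2 := by
    rw [Real.sqrt_le_left (by linarith)]
    nlinarith [sq_nonneg (G.law3 p a b c 2 - G.law3 p a b c 3)]
  have := h G p hp a b c
  linarith

/-- **The (2×) form gives C-026** (`d ≤ 2·d ≤ y₂ + y₃` when `d ≥ 0`; when `d < 0` C-026 holds
trivially, the cells being nonnegative): C-028 strengthens C-026. -/
theorem C026_of_C028Twice (h : C028Twice) : C026 := by
  intro V E _ _ G p hp a b c
  have h1 : 0 ≤ G.law3 p a b c 1 := prob_nonneg hp _
  have h2 : 0 ≤ G.law3 p a b c 2 := prob_nonneg hp _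
  have h3 : 0 ≤ G.law3 p a b c 3 := prob_nonneg hp _
  have := h G p hp a b c
  rcases le_or_gt 0 ((G.law3 p a b c 0 + G.law3 p a b c 1) *
      (G.law3 p a b c 1 + G.law3 p a b c 4) - G.law3 p a b c 1) with hd | hd
  · linarith
  · linarith

/-- **C-028 implies C-026** (row C-028 "strengthens C-026"). -/
theorem C026_of_C028 (h : C028) : C026 := C026_of_C028Twice (C028Twice_of_C028 h)

end PercRepro
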